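import Mathlib

/-!
# The similarity low state of the reduced steady model (solo-blind, s42)

In the `δ → 0` limit of the outer (ℓ, h → 0) steady problem of the laminated reduced model with a
near-root–pinned live block (growth rate `W = 0` enforced by the pattern's own mean-shear correction
`μ = -A q'''`), the pattern intensity in band units `X = x / x_e` is `q = (δ x_e³ / (A |b₀|)) Q(X)` with
`Q''' = X² - 1`, an upstream cubic contact (`Q = Q' = Q'' = 0`) and a downstream tangential contact
(`Q = Q' = 0`).  Writing `X = √6 · Y` makes everything rational: `R(Y) := (Y + 2/3)³ (Y - 1)² / 60`
satisfies `R''' = Y² - 1/6`, has its triple zero at `Y₀ = -2/3` (i.e. `X₀ = -√(8/3)`) and its double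
zero at `Y_R = 1` (i.e. `X_R = √6`), is positive on the live interval, and has mass
`∫_{-2/3}^{1} R = (5/3)⁶ / 3600`.  This file records these facts (the polynomial identities behind the
explicit low branch; CLAIMS SB-C425).
-/

namespace Summit.AnomalousDissipation.AnomalousDissipation.Theorems

open Real

/-- The similarity profile in rational coordinates `Y = X/√6`. -/
noncomputable def simR (Y : ℝ) : ℝ := (Y + 2/3) ^ 3 * (Y - 1) ^ 2 / 60

/-- First derivative of `simR` (explicit quartic). -/
noncomputable def simR1 (Y : ℝ) : ℝ := Y ^ 4 / 12 - Y ^ 2 / 12 - Y / 81 + 1 / 81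
/-- Second derivative of `simR` (explicit cubic). -/
noncomputable def simR2 (Y : ℝ) : ℝ := Y ^ 3 / 3 - Y / 6 - 1 / 81
/-- Third derivative of `simR`: the outer equation's right-hand side `Y² - 1/6`. -/
noncomputable def simR3 (Y : ℝ) : ℝ := Y ^ 2 - 1 / 6

/-- Expanded quintic form of `simR` (no `Y⁴` term, `Y³` coefficient `-1/36`). -/
theorem simR_expand (Y : ℝ) :
    simR Y = Y ^ 5 / 60 - Y ^ 3 / 36 - Y ^ 2 / 162 + Y / 81 + 2 / 405 := by
  unfold simR; ring

/-- `simR' = simR1`. -/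
theorem hasDerivAt_simR (Y : ℝ) : HasDerivAt simR (simR1 Y) Y := by
  have h : simR = fun Y : ℝ => Y ^ 5 / 60 - Y ^ 3 / 36 - Y ^ 2 / 162 + Y / 81 + 2 / 405 := by
    funext Y; exact simR_expand Y
  rw [h]
  have h1 := ((((hasDerivAt_pow 5 Y).div_const 60).sub ((hasDerivAt_pow 3 Y).div_const 36)).sub
    ((hasDerivAt_pow 2 Y).div_const 162)).add ((hasDerivAt_id' Y).div_const 81) |>.add_const (2 / 405)
  have h2 : HasDerivAt (fun Y : ℝ => Y ^ 5 / 60 - Y ^ 3 / 36 - Y ^ 2 / 162 + Y / 81 + 2 / 405)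
      (↑(5:ℕ) * Y ^ (5 - 1) / 60 - ↑(3:ℕ) * Y ^ (3 - 1) / 36 - ↑(2:ℕ) * Y ^ (2 - 1) / 162 + 1 / 81) Y := h1
  refine h2.congr_deriv ?_
  unfold simR1; push_cast; ring

/-- `simR1' = simR2`. -/
theorem hasDerivAt_simR1 (Y : ℝ) : HasDerivAt simR1 (simR2 Y) Y := by
  have h : simR1 = fun Y : ℝ => Y ^ 4 / 12 - Y ^ 2 / 12 - Y / 81 + 1 / 81 := by funext Y; rfl
  rw [h]
  have h1 := ((((hasDerivAt_pow 4 Y).div_const 12).sub ((hasDerivAt_pow 2 Y).div_const 12)).sub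
    ((hasDerivAt_id' Y).div_const 81)).add_const (1 / 81)
  have h2 : HasDerivAt (fun Y : ℝ => Y ^ 4 / 12 - Y ^ 2 / 12 - Y / 81 + 1 / 81)
      (↑(4:ℕ) * Y ^ (4 - 1) / 12 - ↑(2:ℕ) * Y ^ (2 - 1) / 12 - 1 / 81) Y := h1
  refine h2.congr_deriv ?_
  unfold simR2; push_cast; ring

/-- `simR2' = simR3`. -/
theorem hasDerivAt_simR2 (Y : ℝ) : HasDerivAt simR2 (simR3 Y) Y := by
  have h : simR2 = fun Y : ℝ => Y ^ 3 / 3 - Y / 6 - 1 / 81 := by funext Y; rfl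
  rw [h]
  have h1 := (((hasDerivAt_pow 3 Y).div_const 3).sub ((hasDerivAt_id' Y).div_const 6)).sub_const (1 / 81)
  have h2 : HasDerivAt (fun Y : ℝ => Y ^ 3 / 3 - Y / 6 - 1 / 81)
      (↑(3:ℕ) * Y ^ (3 - 1) / 3 - 1 / 6) Y := h1
  refine h2.congr_deriv ?_
  unfold simR3; push_cast; ring

/-- The outer equation `R''' = Y² - 1/6` (i.e. `Q''' = X² - 1` in band units). -/
theorem deriv3_simR : deriv (deriv (deriv simR)) = simR3 := by
  have d1 : deriv simR = simR1 := funext fun Y => (hasDerivAt_simR Y).deriv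
  have d2 : deriv simR1 = simR2 := funext fun Y => (hasDerivAt_simR1 Y).deriv
  have d3 : deriv simR2 = simR3 := funext fun Y => (hasDerivAt_simR2 Y).deriv
  rw [d1, d2, d3]

/-- Upstream cubic contact at `Y₀ = -2/3`: `R = R' = R'' = 0`, with lift-off curvature `R'''(Y₀) = 5/18 > 0`. -/
theorem simR_upstream_contact :
    simR (-2/3) = 0 ∧ simR1 (-2/3) = 0 ∧ simR2 (-2/3) = 0 ∧ simR3 (-2/3) = 5 / 18 := by
  unfold simR simR1 simR2 simR3; norm_num

/-- Downstream tangential contact at `Y_R = 1`: `R = R' = 0` with `R''(1) = 25/162 > 0`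
(the nonzero curvature is the velocity jump absorbed by the downstream mean-flow tail). -/
theorem simR_downstream_contact : simR 1 = 0 ∧ simR1 1 = 0 ∧ simR2 1 = 25 / 162 := by
  unfold simR simR1 simR2; norm_num

/-- Positivity of the intensity on the open live interval. -/
theorem simR_pos {Y : ℝ} (h1 : -2/3 < Y) (h2 : Y < 1) : 0 < simR Y := by
  unfold simR
  have ha0 : 0 < Y + 2/3 := by linarith
  have ha : 0 < (Y + 2/3) ^ 3 := pow_pos ha0 3
  have hb0 : Y - 1 ≠ 0 := by linarith
  have hb : 0 < (Y - 1) ^ 2 := by positivity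
  have := mul_pos ha hb
  positivity

/-- Uniqueness of the contact pair among profiles of the form `c (Y - a)³ (Y - b)²` solving
`R''' = Y² - 1/6`: the vanishing of the `Y⁴` coefficient and the value of the `Y³` coefficient force
`3a + 2b = 0` and `a² = 4/9`; with the upstream contact to the left (`a < b`) this gives `a = -2/3, b = 1`. -/
theorem contact_pair_unique {a b : ℝ} (h4 : 3 * a + 2 * b = 0)
    (h3 : 3 * a ^ 2 + 6 * a * b + b ^ 2 = -5 / 3) (hab : a < b) : a = -2/3 ∧ b = 1 := by
  have hb : b = -3 * a / 2 := by linarith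
  subst hb
  have ha2 : a ^ 2 = 4 / 9 := by nlinarith
  have ha : a = -2/3 := by
    have h := mul_self_eq_mul_self_iff.mp (by nlinarith : a * a = (2/3 : ℝ) * (2/3))
    rcases h with h | h
    · exfalso; subst h; linarith
    · linarith
  refine ⟨ha, ?_⟩
  subst ha; norm_num

/-- An antiderivative of `simR` and the mass of the similarity state:
`∫_{-2/3}^{1} R = F(1) - F(-2/3) = (5/3)⁶/3600 = 15625/2624400`. -/
noncomputable def simF (Y : ℝ) : ℝ := Y ^ 6 / 360 - Y ^ 4 / 144 - Y ^ 3 / 486 + Y ^ 2 / 162 + 2 * Y / 405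

/-- `simF' = simR`. -/
theorem hasDerivAt_simF (Y : ℝ) : HasDerivAt simF (simR Y) Y := by
  have h : simF = fun Y : ℝ => Y ^ 6 / 360 - Y ^ 4 / 144 - Y ^ 3 / 486 + Y ^ 2 / 162 + 2 * Y / 405 := by
    funext Y; rfl
  rw [h]
  have h1 := (((((hasDerivAt_pow 6 Y).div_const 360).sub ((hasDerivAt_pow 4 Y).div_const 144)).sub
    ((hasDerivAt_pow 3 Y).div_const 486)).add ((hasDerivAt_pow 2 Y).div_const 162)).add
    (((hasDerivAt_id' Y).const_mul 2).div_const 405)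
  have h2 : HasDerivAt (fun Y : ℝ => Y ^ 6 / 360 - Y ^ 4 / 144 - Y ^ 3 / 486 + Y ^ 2 / 162 + 2 * Y / 405)
      (↑(6:ℕ) * Y ^ (6 - 1) / 360 - ↑(4:ℕ) * Y ^ (4 - 1) / 144 - ↑(3:ℕ) * Y ^ (3 - 1) / 486
        + ↑(2:ℕ) * Y ^ (2 - 1) / 162 + 2 * 1 / 405) Y := h1
  refine h2.congr_deriv ?_
  rw [simR_expand]; push_cast; ring

/-- Mass of the similarity state: `∫_{-2/3}^{1} simR = (5/3)⁶/3600`. -/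
theorem simR_mass : ∫ Y in (-2/3 : ℝ)..1, simR Y = (5/3 : ℝ) ^ 6 / 3600 := by
  have hcont : ContinuousOn simR (Set.uIcc (-2/3 : ℝ) 1) := by
    have : Continuous simR := by
      have h : simR = fun Y : ℝ => Y ^ 5 / 60 - Y ^ 3 / 36 - Y ^ 2 / 162 + Y / 81 + 2 / 405 := by
        funext Y; exact simR_expand Y
      rw [h]; continuity
    exact this.continuousOn
  rw [intervalIntegral.integral_eq_sub_of_hasDerivAt (fun Y _ => hasDerivAt_simF Y)
    (hcont.intervalIntegrable)]
  unfold simF; norm_num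

end Summit.AnomalousDissipation.AnomalousDissipation.Theorems
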